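import Summits.BirchSwinnertonDyer.BirchSwinnertonDyer.Theorems.ManinLocalTwoThreeDegeneracyUnitTwist
import HarnessLib

/-!
# THEOREM U at `p = 2`, part 1/2: the EVEN relative span lemma (valid at `p = 2`), the prime-generic plus lemma, and the sign
# move to primes `ℓ ≡ 3 (mod 4)` at levels `4 ∣ N`

Summit `BirchSwinnertonDyer`, route `ManinLocalTwoThree` (cell bsd-f2-manin), crux C2 `ManinOddAtFour` (stmt-BirchSwinnertonDyer-22967)
(the `p = 3` twin bears on C3, stmt-…-22968).  At `p = 2` the span lemma of `…TameUnitTwistFourier` is void (`φ(m)` is even); the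
repair is to run Fourier inversion through the EVEN characters only: for an EVEN integer function `F` on `(ℤ/m)ˣ` the odd characters
have `F̂(χ) = 0`, every even `F̂(χ)` is twice an algebraic integer (`Σ_a = 2·Σ_{a mod ±1}`), and `φ(m)/2 = (m − 1)/2` is ODD at primes
`m ≡ 3 (mod 4)` — exactly the conductors the sign move of Lemma G supplies at `4 ∣ N`.

* `Int.dvd_sub_of_forall_even_isIntegral_charSum_div` — `φ(m) = 2n`, `p ∤ n` (any prime `p`), `F` even, `h` a unit: if every
  EVEN `χ` with `χ(h) ≠ 1` has `s·F̂(χ)/(2p)` an algebraic integer (`p ∤ s`), then `p ∣ F(hb) − F(b)` for units `b`.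
* `exists_mem_plus_not_dvd` — the prime-generic form of `exists_mem_plus_not_three_dvd` (a generator with plus part `j·Ω⁺`, `p ∤ j`).
* `exists_degeneracyLoop_prime_mod_four_eq_three` — at `4 ∣ N` every ratio-`t` degeneracy loop has the plus part of one at a prime
  `ℓ' ≡ 3 (mod 4)` (Dirichlet in the class `−ℓ (mod tNb)`; the sign move `modularSymbol_div_eq_conj_of_neg_add`).

HONEST FRAMING: elementary; nothing about C2/C3, Manin's conjecture or BSD is proved here.  No definitions, no named facts, no sorry.
-/

set_option linter.dupNamespace false
set_option autoImplicit false

noncomputable section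

open scoped Classical MatrixGroups ModularForm ComplexConjugate

open CongruenceSubgroup Complex Literature.NumberTheory.EllipticCurves
  Literature.NumberTheory.EllipticCurves.ModularForms
  Summit.BirchSwinnertonDyer.Rank1Residual.ManinAdditive.Gamma1Lattice
  Summit.BirchSwinnertonDyer.Rank1Residual.ManinAdditive.KatoCurve

namespace Summit.BirchSwinnertonDyer.BirchSwinnertonDyer.Theorems.ManinLocalTwoThree

/-! ### §1 The EVEN relative span lemma -/

/-- The character sum of an ODD character against an EVEN integer function vanishes. [folklore] -/
theorem DirichletCharacter.charSum_eq_zero_of_odd {m : ℕ} [NeZero m] (F : ZMod m → ℤ) (hF : ∀ a, F (-a) = F a)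
    {χ : DirichletCharacter ℂ m} (hχ : χ.Odd) : ∑ a : ZMod m, χ a * (F a : ℂ) = 0 := by
  have hneg : ∑ a : ZMod m, χ a * (F a : ℂ) = -∑ a : ZMod m, χ a * (F a : ℂ) := by
    rw [← Finset.sum_neg_distrib]
    refine Fintype.sum_equiv (Equiv.neg (ZMod m)) _ _ fun a ↦ ?_
    rw [Equiv.neg_apply, hχ.eval_neg, hF]; ring
  have := add_eq_zero_iff_eq_neg.mpr hneg
  rw [← two_mul] at this
  exact (mul_eq_zero.mp this).resolve_left two_ne_zero

/-- **The EVEN relative span lemma (every prime `p`, including `p = 2`).**  Let `φ(m) = 2n` with `p ∤ n`, `F : ℤ/m → ℤ` EVEN and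
`h` a unit.  If every EVEN Dirichlet character `χ` mod `m` with `χ(h) ≠ 1` admits `s ∈ ℕ`, `p ∤ s`, with `s·(Σ_a χ(a)F(a))/(2p)` an
algebraic integer, then `p ∣ F(h·b) − F(b)` for every unit `b`.  (Fourier inversion; odd characters drop out because `F` is even,
characters trivial on `h` drop out of the difference; `S·φ(m)·(F(hb) − F(b))/(2p)` is a rational algebraic integer.) [folklore] -/
theorem Int.dvd_sub_of_forall_even_isIntegral_charSum_div {m : ℕ} [NeZero m] {p n : ℕ} (hp : p.Prime)
    (hφ : m.totient = 2 * n) (hpn : ¬ p ∣ n) (F : ZMod m → ℤ) (hF : ∀ a, F (-a) = F a) {h : ZMod m} (hh : IsUnit h)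
    (hH : ∀ χ : DirichletCharacter ℂ m, χ.Even → χ h ≠ 1 →
      ∃ s : ℕ, ¬ p ∣ s ∧ IsIntegral ℤ ((s : ℂ) * (∑ a : ZMod m, χ a * (F a : ℂ)) / (2 * p)))
    {b : ZMod m} (hb : IsUnit b) : (p : ℤ) ∣ F (h * b) - F b := by
  -- one multiplier for all characters
  have h1 : ∀ χ : DirichletCharacter ℂ m, ∃ s : ℕ, ¬ p ∣ s ∧
      (χ.Even ∧ χ h ≠ 1 → IsIntegral ℤ ((s : ℂ) * (∑ a : ZMod m, χ a * (F a : ℂ)) / (2 * p))) := by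
    intro χ
    by_cases hχ : χ.Even ∧ χ h ≠ 1
    · obtain ⟨s, hs, hI⟩ := hH χ hχ.1 hχ.2
      exact ⟨s, hs, fun _ ↦ hI⟩
    · exact ⟨1, hp.one_lt.ne' ∘ Nat.dvd_one.mp, fun h1 ↦ (hχ h1).elim⟩
  choose s hs hI using h1
  set S : ℕ := ∏ χ : DirichletCharacter ℂ m, s χ with hS
  have hpS : ¬ p ∣ S := by
    rw [hS, Prime.dvd_finsetProd_iff hp.prime]
    rintro ⟨χ, -, hχ⟩
    exact hs χ hχ
  have hnat : ∀ K : ℕ, IsIntegral ℤ ((K : ℕ) : ℂ) := fun K ↦ by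
    simpa using isIntegral_algebraMap (R := ℤ) (A := ℂ) (x := (K : ℤ))
  have hSI : ∀ χ : DirichletCharacter ℂ m, χ.Even → χ h ≠ 1 →
      IsIntegral ℤ ((S : ℂ) * (∑ a : ZMod m, χ a * (F a : ℂ)) / (2 * p)) := by
    intro χ hev hχ
    have e : ((S : ℂ) * (∑ a : ZMod m, χ a * (F a : ℂ)) / (2 * p)) =
        ((∏ ψ ∈ (Finset.univ.erase χ), s ψ : ℕ) : ℂ) *
          ((s χ : ℂ) * (∑ a : ZMod m, χ a * (F a : ℂ)) / (2 * p)) := by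
      rw [hS, ← Finset.mul_prod_erase Finset.univ s (Finset.mem_univ χ)]
      push_cast
      ring
    rw [e]
    exact IsIntegral.mul (hnat _) (hI χ ⟨hev, hχ⟩)
  -- units
  obtain ⟨u, rfl⟩ := hh
  obtain ⟨v, rfl⟩ := hb
  have huv : IsUnit ((u : ZMod m) * (v : ZMod m)) := by rw [← Units.val_mul]; exact Units.isUnit _
  have hFhb := DirichletCharacter.sum_inv_mul_charSum_eq (fun a ↦ (F a : ℂ)) huv
  have hFb := DirichletCharacter.sum_inv_mul_charSum_eq (fun a ↦ (F a : ℂ)) (Units.isUnit v)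
  have hdrop : ∀ χ : DirichletCharacter ℂ m, χ (u : ZMod m) = 1 →
      χ ((u : ZMod m) * (v : ZMod m))⁻¹ = χ (v : ZMod m)⁻¹ := by
    intro χ hχ
    have hinv : χ ((u⁻¹ : (ZMod m)ˣ) : ZMod m) = 1 := by
      have := map_mul χ ((u⁻¹ : (ZMod m)ˣ) : ZMod m) (u : ZMod m)
      rw [← Units.val_mul, inv_mul_cancel, Units.val_one, map_one, hχ, mul_one] at this
      exact this.symm
    rw [← Units.val_mul, ZMod.inv_coe_unit, ZMod.inv_coe_unit, mul_inv_rev, Units.val_mul, map_mul, hinv, mul_one]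
  -- the algebraic integer
  set α : ℂ := ∑ χ : DirichletCharacter ℂ m,
    (χ ((u : ZMod m) * (v : ZMod m))⁻¹ - χ (v : ZMod m)⁻¹) * ((S : ℂ) * (∑ a : ZMod m, χ a * (F a : ℂ)) / (2 * p))
    with hα
  have hαI : IsIntegral ℤ α := by
    refine IsIntegral.sum _ fun χ _ ↦ ?_
    rcases χ.even_or_odd with hev | hodd
    · by_cases hχ : χ (u : ZMod m) = 1
      · rw [hdrop χ hχ, sub_self, zero_mul]
        exact isIntegral_zero
      · exact IsIntegral.mul ((DirichletCharacter.isIntegral_apply χ _).sub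
          (DirichletCharacter.isIntegral_apply χ _)) (hSI χ hev hχ)
    · rw [DirichletCharacter.charSum_eq_zero_of_odd F hF hodd, mul_zero, zero_div, mul_zero]
      exact isIntegral_zero
  -- `S · φ(m) · (F (h b) − F b) = 2p · α`
  have hp0 : (p : ℂ) ≠ 0 := by exact_mod_cast hp.ne_zero
  have key : (((S : ℤ) * (m.totient : ℤ) * (F ((u : ZMod m) * (v : ZMod m)) - F (v : ZMod m)) : ℤ) : ℂ) /
      ((2 * p : ℕ) : ℤ) = α := by
    have e1 : α = (S : ℂ) / (2 * p) *
        (∑ χ : DirichletCharacter ℂ m, χ ((u : ZMod m) * (v : ZMod m))⁻¹ * ∑ a : ZMod m, χ a * (F a : ℂ)) -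
        (S : ℂ) / (2 * p) * (∑ χ : DirichletCharacter ℂ m, χ (v : ZMod m)⁻¹ * ∑ a : ZMod m, χ a * (F a : ℂ)) := by
      rw [hα, Finset.mul_sum, Finset.mul_sum, ← Finset.sum_sub_distrib]
      refine Finset.sum_congr rfl fun χ _ ↦ ?_
      field_simp
    rw [e1, hFhb, hFb]
    push_cast
    field_simp
  have hdvd : ((2 * p : ℕ) : ℤ) ∣ (S : ℤ) * (m.totient : ℤ) * (F ((u : ZMod m) * (v : ZMod m)) - F (v : ZMod m)) :=
    Int.dvd_of_isIntegral_intCast_div (by push_cast; exact mul_ne_zero two_ne_zero (by exact_mod_cast hp.ne_zero))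
      (key ▸ hαI)
  rw [hφ] at hdvd
  push_cast at hdvd
  have hdvd' : (p : ℤ) ∣ (S : ℤ) * (n : ℤ) * (F ((u : ZMod m) * (v : ZMod m)) - F (v : ZMod m)) := by
    have e : (S : ℤ) * (2 * (n : ℤ)) * (F ((u : ZMod m) * (v : ZMod m)) - F (v : ZMod m)) =
        2 * ((S : ℤ) * (n : ℤ) * (F ((u : ZMod m) * (v : ZMod m)) - F (v : ZMod m))) := by ring
    rw [e] at hdvd
    exact (mul_dvd_mul_iff_left two_ne_zero).mp hdvd
  have hpZ : Prime (p : ℤ) := Nat.prime_iff_prime_int.mp hp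
  rcases hpZ.dvd_or_dvd hdvd' with h1 | h1
  · rcases hpZ.dvd_or_dvd h1 with h2 | h2
    · exact absurd (Int.natCast_dvd_natCast.mp h2) hpS
    · exact absurd (Int.natCast_dvd_natCast.mp h2) hpn
  · exact h1

/-! ### §2 The prime-generic plus lemma -/

variable {N : ℕ} [NeZero N] {f : CuspForm (Gamma0 N) 2}

/-- For any set `S ⊆ Λ_f` whose closure carries a prime-to-`p` multiple of every plus period, some `z ∈ S` has plus part
`z + z̄ = j·Ω⁺_f` with `p ∤ j` (closure induction; `re Λ_f = ℤ·Ω⁺_f/2`) — prime-generic form of `exists_mem_plus_not_three_dvd`. -/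
theorem exists_mem_plus_not_dvd (hf : IsNewform0 f) (hQ : coeffField f = ⊥) {p : ℕ} {S : Set ℂ}
    (hS : S ⊆ periodLattice f)
    (hd : ∀ x ∈ periodLattice f, ∃ y ∈ AddSubgroup.closure S, ∃ k : ℕ, ¬ p ∣ k ∧
      (k : ℂ) * (x + conj x) = y + conj y) :
    ∃ z ∈ S, ∃ j : ℤ, z + conj z = (j : ℂ) * (plusPeriod f : ℂ) ∧ ¬ (p : ℤ) ∣ j := by
  obtain ⟨hpos, -⟩ := plusPeriod_pos_and_realPeriods_eq isZLattice_periodLattice_holds hf hQ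
  have hΩ : (plusPeriod f : ℂ) ≠ 0 := by exact_mod_cast hpos.ne'
  by_contra hcon
  push Not at hcon
  have hall : ∀ y ∈ AddSubgroup.closure S, ∃ j : ℤ, y + conj y = (j : ℂ) * (plusPeriod f : ℂ) ∧ (p : ℤ) ∣ j := by
    intro y hy
    induction hy using AddSubgroup.closure_induction with
    | mem z hz =>
      obtain ⟨j, hj⟩ := exists_int_add_conj_eq_mul_plusPeriod hf hQ (hS hz)
      exact ⟨j, hj, hcon z hz j hj⟩
    | zero => exact ⟨0, by simp, dvd_zero _⟩
    | add x y _ _ hx hy =>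
      obtain ⟨j₁, hj₁, h₁⟩ := hx
      obtain ⟨j₂, hj₂, h₂⟩ := hy
      refine ⟨j₁ + j₂, ?_, dvd_add h₁ h₂⟩
      rw [map_add, Int.cast_add, add_mul, ← hj₁, ← hj₂]; ring
    | neg x _ hx =>
      obtain ⟨j, hj, h⟩ := hx
      refine ⟨-j, ?_, (dvd_neg).mpr h⟩
      rw [map_neg, Int.cast_neg, neg_mul, ← hj]; ring
  obtain ⟨x₀, hx₀, hx₀Ω⟩ := exists_mem_periodLattice_add_conj_eq_plusPeriod hf hQ
  obtain ⟨y, hy, k, hk3, hk⟩ := hd x₀ hx₀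
  obtain ⟨j, hj, hj3⟩ := hall y hy
  rw [hx₀Ω, hj] at hk
  have hkj : (k : ℤ) = j := by
    have h1 : ((k : ℤ) : ℂ) = (j : ℂ) := by
      have := mul_right_cancel₀ hΩ hk
      exact_mod_cast this
    exact_mod_cast h1
  exact hk3 (Int.natCast_dvd_natCast.mp (hkj ▸ hj3))

/-! ### §3 The sign move to primes `ℓ ≡ 3 (mod 4)` at levels `4 ∣ N` -/

variable (f)

/-- **Every degeneracy loop at `4 ∣ N` has the plus part of one at a prime `ℓ' ≡ 3 (mod 4)`** (Dirichlet in the class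
`−ℓ (mod tNb)` when `ℓ ≡ 1 (mod 4)`; the `p = 2` twin of `exists_degeneracyLoop_prime_mod_three_eq_two`). -/
theorem exists_degeneracyLoop_prime_mod_four_eq_three (hreal : ∀ n, (cuspCoeff f n).im = 0) (h4 : 4 ∣ N) {t : ℕ}
    (ht : 0 < t) {ℓ b : ℕ} (hℓ : ℓ.Prime) (hℓt : ¬ ℓ ∣ t * N) (hℓb : ¬ ℓ ∣ b) :
    ∃ ℓ' : ℕ, ℓ'.Prime ∧ ¬ ℓ' ∣ t * N ∧ ¬ ℓ' ∣ b ∧ ℓ' % 4 = 3 ∧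
      (modularSymbol f (((t * b : ℕ) : ℚ) / ℓ') - modularSymbol f ((b : ℚ) / ℓ')) +
          conj (modularSymbol f (((t * b : ℕ) : ℚ) / ℓ') - modularSymbol f ((b : ℚ) / ℓ')) =
        (modularSymbol f (((t * b : ℕ) : ℚ) / ℓ) - modularSymbol f ((b : ℚ) / ℓ)) +
          conj (modularSymbol f (((t * b : ℕ) : ℚ) / ℓ) - modularSymbol f ((b : ℚ) / ℓ)) := by
  have hℓ2 : ¬ 2 ∣ ℓ := by
    intro h
    have : ℓ = 2 := ((Nat.prime_dvd_prime_iff_eq Nat.prime_two hℓ).mp h).symm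
    exact hℓt (this ▸ dvd_mul_of_dvd_right (dvd_trans (by norm_num) h4) t)
  by_cases hmod : ℓ % 4 = 3
  · exact ⟨ℓ, hℓ, hℓt, hℓb, hmod, rfl⟩
  · have hmod1 : ℓ % 4 = 1 := by omega
    have hb0 : b ≠ 0 := by rintro rfl; exact hℓb (dvd_zero ℓ)
    set q : ℕ := t * N * b with hq
    have hq0 : q ≠ 0 := mul_ne_zero (mul_ne_zero ht.ne' (NeZero.ne N)) hb0
    have hℓq : ¬ ℓ ∣ q := by
      intro h
      rcases (Nat.Prime.dvd_mul hℓ).mp h with h1 | h1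
      · exact hℓt h1
      · exact hℓb h1
    have hcop : IsCoprime (-(ℓ : ℤ)) (q : ℤ) :=
      (Nat.isCoprime_iff_coprime.mpr ((Nat.Prime.coprime_iff_not_dvd hℓ).mpr hℓq)).neg_left
    obtain ⟨ℓ', -, hℓ'p, hℓ'mod⟩ := Nat.forall_exists_prime_gt_and_zmodEq 0 hq0 hcop
    obtain ⟨k, hk⟩ : ∃ k : ℤ, (ℓ : ℤ) = -ℓ' + N * (t * k * b) := by
      obtain ⟨c, hc⟩ := Int.modEq_iff_dvd.mp hℓ'mod.symm
      refine ⟨c, ?_⟩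
      rw [hq] at hc; push_cast at hc; linear_combination hc
    have hℓ'q : ¬ ℓ' ∣ q := by
      intro hd
      have hdZ : (ℓ' : ℤ) ∣ (q : ℤ) := Int.natCast_dvd_natCast.mpr hd
      have h1 : (ℓ' : ℤ) ∣ (ℓ : ℤ) := by
        have e : (ℓ : ℤ) = -ℓ' + k * (q : ℤ) := by rw [hk, hq]; push_cast; ring
        rw [e]
        exact dvd_add (dvd_neg.mpr dvd_rfl) (hdZ.mul_left k)
      have h2 : ℓ' ∣ ℓ := Int.natCast_dvd_natCast.mp h1
      have : ℓ' = ℓ := (Nat.prime_dvd_prime_iff_eq hℓ'p hℓ).mp h2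
      exact hℓq (this ▸ hd)
    refine ⟨ℓ', hℓ'p, fun h ↦ hℓ'q (h.mul_right b), fun h ↦ hℓ'q (h.mul_left _), ?_, ?_⟩
    · have h4q : (4 : ℤ) ∣ (q : ℤ) := by
        rw [hq]; push_cast; exact (dvd_mul_of_dvd_right (by exact_mod_cast h4) _).mul_right _
      have hm4 : (ℓ' : ℤ) ≡ -ℓ [ZMOD 4] := hℓ'mod.of_dvd h4q
      have e1 : ((ℓ' % 4 : ℕ) : ℤ) = ((-(ℓ : ℤ)) % 4) := by push_cast; exact hm4
      omega
    · have hℓ0 : (ℓ : ℤ) ≠ 0 := by exact_mod_cast hℓ.ne_zero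
      have hℓ'0 : (ℓ' : ℤ) ≠ 0 := by exact_mod_cast hℓ'p.ne_zero
      have e1 : modularSymbol f ((b : ℚ) / ℓ) = conj (modularSymbol f ((b : ℚ) / ℓ')) := by
        have := modularSymbol_div_eq_conj_of_neg_add f hreal hℓ0 hℓ'0 (c := b) (K := t * k)
          (by rw [hk]; ring)
        simpa using this
      have e2 : modularSymbol f (((t * b : ℕ) : ℚ) / ℓ) = conj (modularSymbol f (((t * b : ℕ) : ℚ) / ℓ')) := by
        have := modularSymbol_div_eq_conj_of_neg_add f hreal hℓ0 hℓ'0 (c := (t * b : ℕ)) (K := k)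
          (by rw [hk]; push_cast; ring)
        simpa using this
      rw [e1, e2, ← map_sub, Complex.conj_conj, add_comm]

end Summit.BirchSwinnertonDyer.BirchSwinnertonDyer.Theorems.ManinLocalTwoThree

end
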